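import Summits.BirchSwinnertonDyer.Rank1Residual.X12.InertBadLocalTypes
import Summits.BirchSwinnertonDyer.Rank1Residual.Additive.IstarZeroTwistGood
import Literature.NumberTheory.EllipticCurves.PAdicGrossZagierConstantTermProofs
import HarnessLib

/-!
# X12 inert-bad core: Kodaira type `I₀*` at `p` ⟺ SOME quadratic twist has GOOD reduction at `p`
# (CLASS-CLOSURE §3.14 / O10: the sub-partition "principal series e = 2 | supercuspidal e ∈ {3,4,6}"
# as an elementary statement about twists — the defect-2 pairs are exactly the quadratic twists of
# inert-GOOD CM curves, the defect-3/4/6 pairs have NO good quadratic twist at all)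

HONEST FRAMING (cell `b2b-bsdres`, run/shared/lean/b2b/bsd-rank1-residual/, verbatim in every
file): the goal of the cell is to DELETE the COMBINATION-SHAPED residual classes of the
Birch–Swinnerton-Dyer formula for ALL analytic-rank `≤ 1` elliptic curves over `ℚ` — "full BSD
formula for every rank `≤ 1` curve in class `C`" assembled STRICTLY from published theorems — so
that the rank-`≤ 1` remainder becomes exactly the CONSTRUCTION-SHAPED classes, which are TYPED
(missing-input `Prop`s), NOT attempted. This is not "finishing BSD". Unit `b2b-bsdres-x1b` (X12
prover owner, CLASS-CLOSURE class lead O10/O11/O12), generation 25; research route, no claim beyond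
the stated class; X12 REMAINS CONSTRUCTION-SHAPED; nothing is booked here.

Theorems only; no definition, no new named fact. Everything is an ASSEMBLY of tree theorems BY
NAME: the additive sub-cell's `Additive.hasGoodReductionAt_quadraticTwist_of_kodairaSymbolAt_eq_Istar_zero`
(Tate's algorithm Step 6 read backwards: `I₀*` at an odd prime `ℓ ∥ D` ⟹ `W^{(D)}` good) and
`Additive.kodairaSymbolAt_twist_of_semistable` (a uniformiser twist of a good curve is `Iₙ*`),
`WeierstrassCurve.hasGoodReductionAt_quadraticTwist` (a `v`-unit twist of a good curve is good),
the tree's twist algebra (`quadraticTwist_smul`, `quadraticTwist_quadraticTwist`,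
`quadraticTwist_sq_mul`, `exists_variableChange_quadraticTwist_one`, `Rat.exists_sq_mul_squarefree`,
`hasGlobalMinimalModel_rat_holds`), and gen 24's local-type list of the inert-bad core
(`localType_of_classX12_of_cmInert`: `j = 0 ⇒ II/IV/I₀*/IV*/II*`, `j = 1728 ⇒ III/I₀*/III*`,
else `I₀*`).

## What is proved

* §1 (every `E/ℚ`, odd place `v` over `ℓ`): `exists_kodairaSymbolAt_eq_Istar_of_hasGoodReductionAt_twist`
  — if the twist `W^{(D)}` by an integer `D` with `ℓ ∥ D` has good reduction at `v`, then `W` has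
  Kodaira type `Iₙ*` at `v` for some `n`; `not_hasGoodReductionAt_twist_of_not_dvd` — if `W` is BAD
  at `v` then no twist `W^{(D)}` by an integer `D` with `ℓ ∤ D` is good at `v`.
* §2 (the inert-bad core: `ClassX12 W p`, `p ≥ 5`, `CMInert W p`, `v` the place over `p`):
  `kodairaSymbolAt_eq_Istar_zero_iff_hasGoodReductionAt_twist` — for EVERY integer `D` with
  `p ∥ D`: type `I₀*` at `v` ⟺ `W^{(D)}` good at `v`; and the model-free dichotomy
  `exists_hasGoodReductionAt_twist_iff_kodairaSymbolAt_eq_Istar_zero` — SOME quadratic twist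
  `W^{(d)}`, `d ∈ ℚˣ`, has good reduction at `v` ⟺ type `I₀*`. Read with the local-type list: on
  the sub-class of types `II, IV, IV*, II*` (`j = 0`) and `III, III*` (`j = 1728`) — semistability
  defect `e ∈ {3, 4, 6}`, `π_p` supercuspidal — NO quadratic twist of `E` is good at `p`
  (`not_hasGoodReductionAt_twist_of_kodairaSymbolAt_ne_Istar_zero`), while on type `I₀*` (`e = 2`)
  the twist by `p` (equivalently by `p* = ±p`) is a CM curve with GOOD (supersingular) reduction at
  the inert prime `p` — the partner `A = E^{(p*)}` of harvest-1's `X12/GoodTwistDescent.lean` and of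
  the cyclotomic `η = ω^{(p−1)/2}`-branch frame of HOME `b2b-bsdres-x1b/gen25/O10-O11-ANATOMY-v2.md`.

Not claimed: anything about BSD; `p ∈ {2, 3}`; the ramified class O11 (there `p ∣ d_K` and the
type is `III/III*`, gen 24 `RamifiedLocalTypes.lean`, so §1 gives "no good quadratic twist" as
well, but that corollary is not filed here).

References: J. Tate, LNM 476 (1975) §§7–8; J. H. Silverman, *ATAEC* IV.9.4 Steps 6–7, Table 4.1,
Ex. 4.49; *AEC* VII.1 Rem. 1.1, VII.5 Prop. 5.1, X.5 Prop. 5.4; S. Comalada, J. Number Theory 49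
(1994) §2; HOME `b2b-bsdres-x1b/X12-ROUTE.md` §29, `CLASS-CLOSURE-PLAN.md` §3.14.
-/

noncomputable section

open scoped Classical NumberField

open WeierstrassCurve NumberField IsDedekindDomain IsDedekindDomain.HeightOneSpectrum
  Rat.HeightOneSpectrum Literature.NumberTheory.EllipticCurves
  Literature.NumberTheory.EllipticCurves.Rank1Residual
  Literature.NumberTheory.DiophantineGeometry
  Literature.NumberTheory.DiophantineGeometry.TateAlgorithm

namespace Summit.BirchSwinnertonDyer.Rank1Residual.X12

/-! ### §1 Every curve over `ℚ`, odd place -/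

section General

variable (W : WeierstrassCurve ℚ) [W.IsElliptic] (v : HeightOneSpectrum (𝓞 ℚ))

/-- **A globally minimal model of the quadratic twist** (Néron; Silverman *AEC* VIII.8 Cor. 8.3,
the tree's `hasGlobalMinimalModel_rat_holds`): for `d ≠ 0` there is a globally minimal `V/ℚ` and a
change of variables `C` with `C • V = W^{(d)}`. [cite: SilvermanAEC2009, VIII.8 Cor. 8.3] -/
theorem exists_isGloballyMinimal_smul_eq_twist {d : ℚ} (hd : d ≠ 0) :
    ∃ (V : WeierstrassCurve ℚ) (_ : V.IsElliptic) (_ : V.IsGloballyMinimal) (C : VariableChange ℚ),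
      C • V = W.quadraticTwist d := by
  haveI := W.isElliptic_quadraticTwist hd
  obtain ⟨C, hC⟩ := hasGlobalMinimalModel_rat_holds (W.quadraticTwist d)
  exact ⟨C • W.quadraticTwist d, inferInstance, hC, C⁻¹, inv_smul_smul C _⟩

omit [W.IsElliptic] in
/-- **Twisting back.** If `C • V = W^{(d)}` with `d ≠ 0`, then `W` is `ℚ`-isomorphic to the twist
`V^{(d)}`: `C' • V^{(d)} = W` for an explicit `C'` (`(C • V)^{(d)} = (u, dr, 0, 0) • V^{(d)}`,
`(W^{(d)})^{(d)} = W^{(d²)} = (1/d, 0, 0, 0) • W^{(1)}`, `W^{(1)} = C₁ • W`).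
[cite: SilvermanAEC2009, X.5 Prop. 5.4 and Cor. 5.4.1] -/
theorem exists_smul_twist_eq_of_smul_eq_twist {d : ℚ} (hd : d ≠ 0) {V : WeierstrassCurve ℚ}
    {C : VariableChange ℚ} (hC : C • V = W.quadraticTwist d) :
    ∃ C' : VariableChange ℚ, C' • V.quadraticTwist d = W := by
  obtain ⟨C₁, hC₁⟩ := W.exists_variableChange_quadraticTwist_one
  -- `(C • V)^{(d)} = T • V^{(d)}` with `T = (C.u, d C.r, 0, 0)`
  have hT : (C • V).quadraticTwist d =
      (⟨C.u, d * C.r, 0, 0⟩ : VariableChange ℚ) • V.quadraticTwist d := V.quadraticTwist_smul C d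
  -- `(W^{(d)})^{(d)} = W^{(d²·1)} = S • W^{(1)} = (S * C₁) • W`
  have hsq : (W.quadraticTwist d).quadraticTwist d =
      ((⟨(Units.mk0 d hd)⁻¹, 0, 0, 0⟩ : VariableChange ℚ) * C₁) • W := by
    rw [quadraticTwist_quadraticTwist, show d * d = d ^ 2 * 1 by ring, W.quadraticTwist_sq_mul hd,
      mul_smul, hC₁]
  refine ⟨((⟨(Units.mk0 d hd)⁻¹, 0, 0, 0⟩ : VariableChange ℚ) * C₁)⁻¹ *
    (⟨C.u, d * C.r, 0, 0⟩ : VariableChange ℚ), ?_⟩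
  rw [mul_smul, ← hT, hC, hsq, inv_smul_smul]

/-- **If a uniformiser twist is good, the curve is `Iₙ*`.** Let `v` be a place of `ℚ` over an odd
prime `ℓ` and `D ∈ ℤ` with `ℓ ∥ D`. If the quadratic twist `W^{(D)}` has GOOD reduction at `v`,
then `W` has Kodaira type `Iₙ*` at `v` for some `n ≥ 0`: a globally minimal model `V` of
`W^{(D)}` is good at `v` and `W ≅ V^{(D)}` (`exists_smul_twist_eq_of_smul_eq_twist`), so the
additive sub-cell's `Additive.kodairaSymbolAt_twist_of_semistable` (Tate's algorithm Steps 6–7 on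
the uniformiser twist of a semistable equation) applies.
[cite: SilvermanATAEC1994, IV.9.4 Steps 6–7 (PDF pp. 345–346)] [cite: SilvermanAEC2009, VII.1 Remark 1.1] -/
theorem exists_kodairaSymbolAt_eq_Istar_of_hasGoodReductionAt_twist (hv2 : natGenerator v ≠ 2)
    {D : ℤ} (h1 : (natGenerator v : ℤ) ∣ D) (h2 : ¬ (natGenerator v : ℤ) ^ 2 ∣ D)
    (hgood : (W.quadraticTwist (D : ℚ)).HasGoodReductionAt v) :
    ∃ n : ℕ, W.kodairaSymbolAt v = .Istar n := by
  have hD0 : D ≠ 0 := by rintro rfl; exact h2 (dvd_zero _)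
  have hD0' : (D : ℚ) ≠ 0 := by exact_mod_cast hD0
  obtain ⟨V, _, _, C, hC⟩ := exists_isGloballyMinimal_smul_eq_twist W hD0'
  have hVgood : V.HasGoodReductionAt v := by
    rw [← hasGoodReductionAt_smul_iff_holds v V C, hC]; exact hgood
  obtain ⟨C', hC'⟩ := exists_smul_twist_eq_of_smul_eq_twist W hD0' hC
  exact Additive.kodairaSymbolAt_twist_of_semistable v V hv2 hD0 h1 h2 (Or.inl hVgood) C' hC'

/-- **A `v`-unit twist of a bad curve is bad.** Let `v` be a place of `ℚ` over an odd prime `ℓ`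
and `D ∈ ℤ` with `ℓ ∤ D`. If `W` is BAD at `v`, then so is `W^{(D)}`: otherwise a globally
minimal model `V` of `W^{(D)}` is good at `v` (`ℓ ∤ Δ_min(V)`), `W ≅ V^{(D)}`, and the tree's
`WeierstrassCurve.hasGoodReductionAt_quadraticTwist` (`ℓ ∤ 2D·Δ_min`) makes `W` good.
[cite: SilvermanAEC2009, VII.1 Remark 1.1 and VII.5 Prop. 5.1(a)] -/
theorem not_hasGoodReductionAt_twist_of_not_dvd (hv2 : natGenerator v ≠ 2) {D : ℤ} (hD0 : D ≠ 0)
    (hD : ¬ (natGenerator v : ℤ) ∣ D) (hbad : ¬ W.HasGoodReductionAt v) :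
    ¬ (W.quadraticTwist (D : ℚ)).HasGoodReductionAt v := by
  intro hgood
  have hD0' : (D : ℚ) ≠ 0 := by exact_mod_cast hD0
  obtain ⟨V, _, _, C, hC⟩ := exists_isGloballyMinimal_smul_eq_twist W hD0'
  have hVgood : V.HasGoodReductionAt v := by
    rw [← hasGoodReductionAt_smul_iff_holds v V C, hC]; exact hgood
  obtain ⟨C', hC'⟩ := exists_smul_twist_eq_of_smul_eq_twist W hD0' hC
  haveI : Fact (primesEquiv v : ℕ).Prime := ⟨(primesEquiv v).2⟩
  have hpP : (natGenerator v).Prime := prime_natGenerator v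
  have hpZ : Prime ((natGenerator v : ℕ) : ℤ) := Nat.prime_iff_prime_int.mp hpP
  have hp2 : ¬ ((natGenerator v : ℕ) : ℤ) ∣ 2 := fun h ↦
    hv2 ((Nat.prime_dvd_prime_iff_eq hpP Nat.prime_two).mp (Int.natCast_dvd_natCast.mp h))
  have h2D : ¬ ((primesEquiv v : ℕ) : ℤ) ∣ 2 * D := by
    rw [show (primesEquiv v : ℕ) = natGenerator v from rfl]
    exact fun h ↦ (hpZ.dvd_or_dvd h).elim hp2 hD
  have hΔ : ¬ ((primesEquiv v : ℕ) : ℤ) ∣ minimalDiscriminantInt V :=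
    V.not_dvd_minimalDiscriminantInt_of_hasGoodReductionAtPrime' (primesEquiv v : ℕ)
      ((hasGoodReductionAtPrime_iff_hasGoodReductionAt_ringOfIntegers v V).mpr hVgood)
  have hWgood : (V.quadraticTwist (D : ℚ)).HasGoodReductionAt v :=
    V.hasGoodReductionAt_quadraticTwist v h2D hΔ
  rw [← hC', hasGoodReductionAt_smul_iff_holds v _ C'] at hbad
  exact hbad hWgood

end General

/-! ### §2 The inert-bad core: `I₀*` ⟺ a good quadratic twist exists -/

section Core

variable (W : WeierstrassCurve ℚ) [W.IsElliptic] (p : ℕ) [hp : Fact p.Prime]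

/-- **Defect 2 ⟺ the uniformiser twist is good.** For `W/ℚ` in class X12 at a prime `p ≥ 5`
INERT in the CM field (the O10 core), at the place `v` over `p` and for EVERY integer `D` with
`p ∥ D` (e.g. `D = p` or `D = p* = ±p`): Kodaira type `I₀*` at `v` ⟺ the quadratic twist `W^{(D)}`
has GOOD reduction at `v`. (⟹) is the additive sub-cell's
`Additive.hasGoodReductionAt_quadraticTwist_of_kodairaSymbolAt_eq_Istar_zero` (Tate Step 6 read
backwards); (⟸) is §1 plus gen 24's local-type list of the core (`localType_of_classX12_of_cmInert`),
in which the only `Iₙ*` is `I₀*`.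
[cite: SilvermanATAEC1994, IV.9.4 Step 6, Table 4.1 and Ex. 4.49] [cite: SilvermanAEC2009, X.5 Prop. 5.4] -/
theorem kodairaSymbolAt_eq_Istar_zero_iff_hasGoodReductionAt_twist (hX : ClassX12 W p)
    (hp5 : 5 ≤ p) (hin : CMInert W p) (v : HeightOneSpectrum (𝓞 ℚ)) (hv : natGenerator v = p)
    {D : ℤ} (h1 : (p : ℤ) ∣ D) (h2 : ¬ (p : ℤ) ^ 2 ∣ D) :
    W.kodairaSymbolAt v = .Istar 0 ↔ (W.quadraticTwist (D : ℚ)).HasGoodReductionAt v := by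
  have hv2 : natGenerator v ≠ 2 := by rw [hv]; omega
  have h1' : (natGenerator v : ℤ) ∣ D := by rw [hv]; exact h1
  have h2' : ¬ (natGenerator v : ℤ) ^ 2 ∣ D := by rw [hv]; exact h2
  constructor
  · intro hK
    exact Additive.hasGoodReductionAt_quadraticTwist_of_kodairaSymbolAt_eq_Istar_zero v W
      (show (primesEquiv v : ℕ) ≠ 2 from hv2) h1' h2' hK
  · intro hgood
    obtain ⟨n, hn⟩ := exists_kodairaSymbolAt_eq_Istar_of_hasGoodReductionAt_twist W v hv2 h1' h2' hgood
    rcases localType_of_classX12_of_cmInert W p hX hp5 hin v hv with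
      ⟨-, -, hk⟩ | ⟨-, -, hk⟩ | ⟨-, -, hk⟩
    · rcases hk with h | h | h | h | h <;> rw [hn] at h ⊢ <;> first | exact h | simp at h
    · rcases hk with h | h | h <;> rw [hn] at h ⊢ <;> first | exact h | simp at h
    · rw [hn] at hk ⊢; exact hk

/-- **On the sub-class of types `≠ I₀*` (defect 3, 4, 6) NO quadratic twist is good at `p`.** For
`W/ℚ` in class X12 at a prime `p ≥ 5` inert in the CM field with Kodaira type `≠ I₀*` at the place
`v` over `p`, and every `d ∈ ℚ`, `d ≠ 0`: the twist `W^{(d)}` is BAD at `v`. Writing `d = c²n`,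
`n` a square-free integer (`Rat.exists_sq_mul_squarefree`, `W^{(c²n)} ≅ W^{(n)}`): `p ∥ n` is the
previous theorem, `p ∤ n` is §1's `not_hasGoodReductionAt_twist_of_not_dvd` (`W` is bad at `v`).
[cite: SilvermanATAEC1994, IV.9.4 Step 6 and Table 4.1] [cite: SilvermanAEC2009, X.5 Prop. 5.4] -/
theorem not_hasGoodReductionAt_twist_of_kodairaSymbolAt_ne_Istar_zero (hX : ClassX12 W p)
    (hp5 : 5 ≤ p) (hin : CMInert W p) (v : HeightOneSpectrum (𝓞 ℚ)) (hv : natGenerator v = p)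
    (hK : W.kodairaSymbolAt v ≠ .Istar 0) {d : ℚ} (hd : d ≠ 0) :
    ¬ (W.quadraticTwist d).HasGoodReductionAt v := by
  have hpP : p.Prime := hp.out
  have hv2 : natGenerator v ≠ 2 := by rw [hv]; omega
  have hbad : ¬ W.HasGoodReductionAt v := not_hasGoodReductionAt_of_classX12_of_five_le W p hX hp5 v hv
  obtain ⟨c, n, hc, hsq, hdn⟩ := Rat.exists_sq_mul_squarefree hd
  have hn0 : n ≠ 0 := by rintro rfl; simp at hdn; exact hd hdn
  -- `W^{(d)} = W^{(c² n)} ≅ W^{(n)}`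
  have hiso : W.quadraticTwist d =
      (⟨(Units.mk0 c hc)⁻¹, 0, 0, 0⟩ : VariableChange ℚ) • W.quadraticTwist (n : ℚ) := by
    rw [hdn, W.quadraticTwist_sq_mul hc]
  rw [hiso, hasGoodReductionAt_smul_iff_holds v _ _]
  by_cases hpn : (p : ℤ) ∣ n
  · -- `p ∥ n`
    have hp2n : ¬ (p : ℤ) ^ 2 ∣ n := fun h9 ↦ by
      have hu := hsq (p : ℤ) (by simpa [sq] using h9)
      rw [Int.isUnit_iff] at hu
      have := hpP.two_le
      omega
    rw [← kodairaSymbolAt_eq_Istar_zero_iff_hasGoodReductionAt_twist W p hX hp5 hin v hv hpn hp2n]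
    exact hK
  · -- `p ∤ n`
    exact not_hasGoodReductionAt_twist_of_not_dvd W v hv2 hn0 (by rw [hv]; exact hpn) hbad

/-- **THE DICHOTOMY (model-free form).** For `W/ℚ` in class X12 at a prime `p ≥ 5` inert in the
CM field, at the place `v` over `p`: SOME quadratic twist `W^{(d)}` (`d ∈ ℚ`, `d ≠ 0`) has good
reduction at `v` ⟺ `W` has Kodaira type `I₀*` at `v` (semistability defect `2`); and then already
`W^{(p)}` is good. So the E2 sub-partition of the O10 core "e = 2 | e ∈ {3, 4, 6}" (principal
series | supercuspidal at `p`) is "E is a quadratic twist of a CM curve GOOD at `p` | E has no good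
quadratic twist at `p`". [cite: SilvermanATAEC1994, IV.9.4 Step 6, Table 4.1 and Ex. 4.49]
[cite: SilvermanAEC2009, X.5 Prop. 5.4] -/
theorem exists_hasGoodReductionAt_twist_iff_kodairaSymbolAt_eq_Istar_zero (hX : ClassX12 W p)
    (hp5 : 5 ≤ p) (hin : CMInert W p) (v : HeightOneSpectrum (𝓞 ℚ)) (hv : natGenerator v = p) :
    (∃ d : ℚ, d ≠ 0 ∧ (W.quadraticTwist d).HasGoodReductionAt v) ↔
      W.kodairaSymbolAt v = .Istar 0 := by
  constructor
  · rintro ⟨d, hd, hgood⟩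
    by_contra hK
    exact not_hasGoodReductionAt_twist_of_kodairaSymbolAt_ne_Istar_zero W p hX hp5 hin v hv hK hd hgood
  · intro hK
    have hpP : p.Prime := hp.out
    refine ⟨(p : ℚ), by exact_mod_cast hpP.ne_zero, ?_⟩
    have h := (kodairaSymbolAt_eq_Istar_zero_iff_hasGoodReductionAt_twist W p hX hp5 hin v hv
      (D := (p : ℤ)) dvd_rfl ?_).mp hK
    · exact_mod_cast h
    · intro h2
      have hp0 : (p : ℤ) ≠ 0 := by exact_mod_cast hpP.ne_zero
      have h1 : (p : ℤ) * p ∣ (p : ℤ) * 1 := by simpa [sq] using h2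
      have hp1 : (p : ℤ) ∣ 1 := (mul_dvd_mul_iff_left hp0).mp h1
      have := Int.eq_one_of_dvd_one (by positivity) hp1
      have h1' : p = 1 := by exact_mod_cast this
      exact hpP.one_lt.ne' h1'

/-- **The good partner (bookkeeping).** For `W/ℚ` in class X12 at a prime `p ≥ 5` inert in the
CM field with Kodaira type `I₀*` at the place `v` over `p`, there is a GLOBALLY MINIMAL elliptic
curve `A/ℚ` with GOOD reduction at `v` and the SAME `j`-invariant (hence CM by the same field, in
which `p` is inert: `A` is supersingular at `p`) such that `W ≅ A^{(p)}` over `ℚ` — the partner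
`A = E^{(±p)}` of the `η = ω^{(p−1)/2}`-branch frame and of `X12/GoodTwistDescent.lean`.
[cite: SilvermanAEC2009, X.5 Prop. 5.4 and Cor. 5.4.1] [cite: SilvermanATAEC1994, IV.9.4 Step 6 and Ex. 4.49] -/
theorem exists_good_partner_of_kodairaSymbolAt_eq_Istar_zero (hX : ClassX12 W p) (hp5 : 5 ≤ p)
    (hin : CMInert W p) (v : HeightOneSpectrum (𝓞 ℚ)) (hv : natGenerator v = p)
    (hK : W.kodairaSymbolAt v = .Istar 0) :
    ∃ (A : WeierstrassCurve ℚ) (_ : A.IsElliptic) (_ : A.IsGloballyMinimal),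
      A.HasGoodReductionAt v ∧ A.j = W.j ∧
        ∃ C : VariableChange ℚ, C • A.quadraticTwist (p : ℚ) = W := by
  have hpP : p.Prime := hp.out
  have hp0 : (p : ℚ) ≠ 0 := by exact_mod_cast hpP.ne_zero
  have h2 : ¬ (p : ℤ) ^ 2 ∣ (p : ℤ) := by
    intro h2
    have hp0' : (p : ℤ) ≠ 0 := by exact_mod_cast hpP.ne_zero
    have h1 : (p : ℤ) * p ∣ (p : ℤ) * 1 := by simpa [sq] using h2
    have hp1 : (p : ℤ) ∣ 1 := (mul_dvd_mul_iff_left hp0').mp h1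
    have := Int.eq_one_of_dvd_one (by positivity) hp1
    have h1' : p = 1 := by exact_mod_cast this
    exact hpP.one_lt.ne' h1'
  have hgood : (W.quadraticTwist ((p : ℤ) : ℚ)).HasGoodReductionAt v :=
    (kodairaSymbolAt_eq_Istar_zero_iff_hasGoodReductionAt_twist W p hX hp5 hin v hv dvd_rfl h2).mp hK
  have hgood' : (W.quadraticTwist (p : ℚ)).HasGoodReductionAt v := by exact_mod_cast hgood
  obtain ⟨A, hAe, hAm, C, hC⟩ := exists_isGloballyMinimal_smul_eq_twist W hp0
  have hAgood : A.HasGoodReductionAt v := by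
    rw [← hasGoodReductionAt_smul_iff_holds v A C, hC]; exact hgood'
  obtain ⟨C', hC'⟩ := exists_smul_twist_eq_of_smul_eq_twist W hp0 hC
  haveI hell : (W.quadraticTwist (p : ℚ)).IsElliptic := W.isElliptic_quadraticTwist hp0
  have hj : A.j = W.j := by
    have h1 : (C • A).j = A.j := variableChange_j A C
    have h2 : (C • A).j = (W.quadraticTwist (p : ℚ)).j := by
      have key : ∀ (X Y : WeierstrassCurve ℚ) (hX : X.IsElliptic) (hY : Y.IsElliptic),
          X = Y → X.j = Y.j := by
        intro X Y hX hY h; subst h; rfl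
      exact key _ _ _ _ hC
    rw [← h1, h2]
    exact W.j_quadraticTwist hp0
  exact ⟨A, hAe, hAm, hAgood, hj, C', hC'⟩

end Core

end Summit.BirchSwinnertonDyer.Rank1Residual.X12

end
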